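import Literature.Topology.PlanarFoliations.JordanSack
import HarnessLib

/-!
# Monotonicity of the crossings of an open leaf with a vertical

Topic: Topology / PlanarFoliations, sequel to `JordanSack.lean` (the Bendixson sack of two
successive crossings). Consequences for all the crossings of an open leaf `L = F.Leaf x` of a
bi-oriented planar foliation with the vertical `u = u₀` of a flow box `e`:

* `ht_not_mem_Ioo` (**proved**): if `p < q < r` are crossings, the height of `r` is not strictly
  between the heights of `p` and `q` (strong induction on the number of intermediate crossings,
  the base case being the sack lemma `SackData.ht_not_mem_Ioo_of_lt`);
* `wcrossing_monotone` (**proved**): inside a height window `(T₁, T₂)`, after two consecutive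
  window crossings `p < q` all later window crossings progress strictly monotonically in the
  direction from `ht p` to `ht q`, each beyond all the earlier ones (strong induction, peeling
  off the last window crossing and applying `SackData.beyond_of_lt`).

These are the classical monotonicity statements of Poincaré–Bendixson theory ("successive
intersections of an orbit with a transverse segment are monotone"). All statements are
[folklore] (Bendixson 1901; Camacho–Lins Neto Ch. VI §4; Hector–Hirsch A).
-/

noncomputable section

open Set Filter Function
open _root_.Topology
open Literature.Topology.FourManifolds Literature.Topology.FourManifolds.Foliation
  Literature.Topology.FourManifolds.OneManifold Literature.Topology.PlaneTopology

namespace Literature.Topology.PlanarFoliations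

variable {X : Type*} [TopologicalSpace X] [T2Space X] [SecondCountableTopology X] {F : Foliation ℝ X}
variable {hbi : IsBiOriented F} {e : OpenPartialHomeomorph X (ℝ × ℝ)} {u₀ : ℝ}

/-! ## Monotonicity of the crossings -/

section Monotone

variable {x : X} [NoncompactSpace (F.Leaf x)]

/-- The crossings in `[p, q]` with heights between those of `p` and `q`. [folklore] -/
def crossSet (hbi : IsBiOriented F) (e : OpenPartialHomeomorph X (ℝ × ℝ)) (u₀ : ℝ) (p q : F.Leaf x) : Set (F.Leaf x) :=
  {s ∈ leafIcc hbi p q | IsCrossing e u₀ s ∧ ht e s ∈ uIcc (ht e p) (ht e q)}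

/-- The intermediate crossings form a finite set. [folklore] -/
theorem finite_crossSet (he : e ∈ F.atlas) (p q : F.Leaf x) : (crossSet hbi e u₀ p q).Finite :=
  finite_crossings_leafIcc hbi he isCompact_uIcc.isClosed isCompact_uIcc.isBounded p q

/-- **Monotonicity of the crossings** (Poincaré–Bendixson): if `p < q < r` are crossings of an
open leaf with the vertical `u = u₀` of a flow box, the height of `r` is not strictly between the
heights of `p` and `q`. By induction on the number of crossings in `[p, q]` with intermediate
heights: with none, this is the sack lemma; otherwise split at such a crossing. [folklore] -/
theorem ht_not_mem_Ioo (he : e ∈ F.atlas) {ι : X → ℂ} (hι : IsOpenEmbedding ι) {p q r : F.Leaf x}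
    (hpq : leafLT hbi p q) (hqr : leafLT hbi q r) (hp : IsCrossing e u₀ p) (hq : IsCrossing e u₀ q)
    (hr : IsCrossing e u₀ r) : ht e r ∉ Ioo (min (ht e p) (ht e q)) (max (ht e p) (ht e q)) := by
  -- strong induction on the number of intermediate crossings
  suffices H : ∀ (n : ℕ) (p q : F.Leaf x), (finite_crossSet (hbi := hbi) (u₀ := u₀) he p q).toFinset.card ≤ n →
      leafLT hbi p q → leafLT hbi q r → IsCrossing e u₀ p → IsCrossing e u₀ q →
      ht e r ∉ Ioo (min (ht e p) (ht e q)) (max (ht e p) (ht e q)) from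
    H _ p q le_rfl hpq hqr hp hq
  intro n
  induction n with
  | zero =>
    -- no crossings at all in `[p, q]`: impossible since `p` is one
    intro p q hcard hpq _ hp _
    have hpmem : p ∈ (finite_crossSet (hbi := hbi) (u₀ := u₀) he p q).toFinset := by
      rw [Set.Finite.mem_toFinset]
      exact ⟨left_mem_leafIcc (leafLT_asymm hpq), hp, left_mem_uIcc⟩
    have := Finset.card_pos.2 ⟨p, hpmem⟩
    omega
  | succ n ih =>
    intro p q hcard hpq hqr hp hq hrI
    by_cases hsucc : ∀ s, leafLT hbi p s → leafLT hbi s q → IsCrossing e u₀ s → ht e s ∉ uIcc (ht e q) (ht e p)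
    · -- successive: the sack lemma
      set D : SackData hbi x e u₀ := ⟨p, q, hpq, hp, hq, hsucc⟩ with hD
      exact D.ht_not_mem_Ioo_of_lt he hι hqr hr hrI
    · push Not at hsucc
      obtain ⟨s, hps, hsq, hs, hsI⟩ := hsucc
      -- the intermediate crossing `s` has height strictly between
      have hsp : ht e s ≠ ht e p := fun h ↦ leafLT_irrefl (hbi := hbi) p (by rwa [hs.eq_of_ht_eq hp h] at hps)
      have hsq' : ht e s ≠ ht e q := fun h ↦ leafLT_irrefl (hbi := hbi) q (by rwa [hs.eq_of_ht_eq hq h] at hsq)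
      have hrs : ht e r ≠ ht e s := fun h ↦
        leafLT_asymm hsq (by rw [hr.eq_of_ht_eq hs h] at hqr; exact hqr)
      rw [uIcc_comm] at hsI
      -- the two sub-pairs have fewer intermediate crossings
      have hsub₁ : crossSet hbi e u₀ p s ⊆ crossSet hbi e u₀ p q := by
        rintro w ⟨⟨hw₁, hw₂⟩, hw, hwI⟩
        refine ⟨⟨hw₁, fun hqw ↦ hw₂ (leafLT_trans hsq hqw)⟩, hw, ?_⟩
        exact uIcc_subset_uIcc left_mem_uIcc hsI hwI
      have hsub₂ : crossSet hbi e u₀ s q ⊆ crossSet hbi e u₀ p q := by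
        rintro w ⟨⟨hw₁, hw₂⟩, hw, hwI⟩
        refine ⟨⟨fun hwp ↦ hw₁ (leafLT_trans hwp hps), hw₂⟩, hw, ?_⟩
        exact uIcc_subset_uIcc hsI right_mem_uIcc hwI
      have hq₁ : q ∈ crossSet hbi e u₀ p q ∧ q ∉ crossSet hbi e u₀ p s :=
        ⟨⟨right_mem_leafIcc (leafLT_asymm hpq), hq, right_mem_uIcc⟩, fun h ↦ h.1.2 hsq⟩
      have hp₂ : p ∈ crossSet hbi e u₀ p q ∧ p ∉ crossSet hbi e u₀ s q :=
        ⟨⟨left_mem_leafIcc (leafLT_asymm hpq), hp, left_mem_uIcc⟩, fun h ↦ h.1.1 hps⟩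
      have hcard₁ : (finite_crossSet (hbi := hbi) (u₀ := u₀) he p s).toFinset.card ≤ n := by
        have hss : (finite_crossSet (hbi := hbi) (u₀ := u₀) he p s).toFinset ⊂
            (finite_crossSet (hbi := hbi) (u₀ := u₀) he p q).toFinset := by
          rw [Set.Finite.toFinset_ssubset_toFinset]
          exact ⟨hsub₁, fun h ↦ hq₁.2 (h hq₁.1)⟩
        have := Finset.card_lt_card hss
        omega
      have hcard₂ : (finite_crossSet (hbi := hbi) (u₀ := u₀) he s q).toFinset.card ≤ n := by
        have hss : (finite_crossSet (hbi := hbi) (u₀ := u₀) he s q).toFinset ⊂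
            (finite_crossSet (hbi := hbi) (u₀ := u₀) he p q).toFinset := by
          rw [Set.Finite.toFinset_ssubset_toFinset]
          exact ⟨hsub₂, fun h ↦ hp₂.2 (h hp₂.1)⟩
        have := Finset.card_lt_card hss
        omega
      have ih₁ := ih p s hcard₁ hps (leafLT_trans hsq hqr) hp hs
      have ih₂ := ih s q hcard₂ hsq hqr hs hq
      -- case analysis on the position of `ht r` relative to `ht s`
      have hsI' : min (ht e p) (ht e q) < ht e s ∧ ht e s < max (ht e p) (ht e q) := by
        rw [mem_uIcc] at hsI
        rcases hsI with ⟨h1, h2⟩ | ⟨h1, h2⟩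
        · exact ⟨(min_le_left _ _).trans_lt (h1.lt_of_ne hsp.symm), (h2.lt_of_ne hsq').trans_le (le_max_right _ _)⟩
        · exact ⟨(min_le_right _ _).trans_lt (h1.lt_of_ne (Ne.symm hsq')), (h2.lt_of_ne hsp).trans_le (le_max_left _ _)⟩
      have hpqne : ht e p ≠ ht e q := fun h ↦ by
        have h' := hp.eq_of_ht_eq hq h
        rw [h'] at hpq
        exact leafLT_irrefl q hpq
      rcases lt_or_gt_of_ne hpqne with hpq' | hqp'
      · -- `ht p < ht q`
        rw [min_eq_left hpq'.le, max_eq_right hpq'.le] at hrI hsI'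
        rcases lt_or_gt_of_ne hrs with hlt | hgt
        · -- `ht r < ht s`: use the pair `(p, s)`
          apply ih₁
          rw [min_eq_left hsI'.1.le, max_eq_right hsI'.1.le]
          exact ⟨hrI.1, hlt⟩
        · -- `ht s < ht r`: use the pair `(s, q)`
          apply ih₂
          rw [min_eq_left hsI'.2.le, max_eq_right hsI'.2.le]
          exact ⟨hgt, hrI.2⟩
      · -- `ht q < ht p`
        rw [min_eq_right hqp'.le, max_eq_left hqp'.le] at hrI hsI'
        rcases lt_or_gt_of_ne hrs with hlt | hgt
        · -- `ht r < ht s`: use the pair `(s, q)`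
          apply ih₂
          rw [min_eq_right hsI'.1.le, max_eq_left hsI'.1.le]
          exact ⟨hrI.1, hlt⟩
        · -- `ht s < ht r`: use the pair `(p, s)`
          apply ih₁
          rw [min_eq_right hsI'.2.le, max_eq_left hsI'.2.le]
          exact ⟨hgt, hrI.2⟩

/-! ### Monotone chains of window crossings -/

/-- Sign transfer: `0 < A·B` and `0 < B·C` give `0 < A·C`. [folklore] -/
theorem mul_pos_of_mul_pos_of_mul_pos {A B C : ℝ} (h₁ : 0 < A * B) (h₂ : 0 < B * C) : 0 < A * C := by
  rcases lt_trichotomy B 0 with hB | hB | hB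
  · have hA : A < 0 := by nlinarith
    have hC : C < 0 := by nlinarith
    nlinarith
  · rw [hB, mul_zero] at h₁; exact absurd h₁ (lt_irrefl 0)
  · have hA : 0 < A := by nlinarith
    have hC : 0 < C := by nlinarith
    nlinarith

/-- A **window crossing**: a crossing with height in the open window `(T₁, T₂)`. [folklore] -/
def IsWCrossing (e : OpenPartialHomeomorph X (ℝ × ℝ)) (u₀ T₁ T₂ : ℝ) (q : F.Leaf x) : Prop :=
  IsCrossing e u₀ q ∧ ht e q ∈ Ioo T₁ T₂

/-- **The last window crossing before `r'` (after `q`).** [folklore] -/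
theorem exists_last_wcrossing (he : e ∈ F.atlas) {T₁ T₂ : ℝ} {q r' : F.Leaf x}
    (h : ∃ s, IsWCrossing e u₀ T₁ T₂ s ∧ leafLT hbi q s ∧ leafLT hbi s r') :
    ∃ s, IsWCrossing e u₀ T₁ T₂ s ∧ leafLT hbi q s ∧ leafLT hbi s r' ∧
      ∀ s', IsWCrossing e u₀ T₁ T₂ s' → leafLT hbi q s' → leafLT hbi s' r' → ¬ leafLT hbi s s' := by
  set S : Set (F.Leaf x) := {s ∈ leafIcc hbi q r' | IsCrossing e u₀ s ∧ ht e s ∈ Icc T₁ T₂} ∩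
    {s | IsWCrossing e u₀ T₁ T₂ s ∧ leafLT hbi q s ∧ leafLT hbi s r'} with hS
  have hSf : S.Finite := (finite_crossings_leafIcc hbi he isClosed_Icc (Metric.isBounded_Icc _ _) q r').inter_of_left _
  obtain ⟨s₀, hs₀, hqs₀, hs₀r⟩ := h
  have hs₀S : s₀ ∈ S := ⟨⟨⟨leafLT_asymm hqs₀, leafLT_asymm hs₀r⟩, hs₀.1, Ioo_subset_Icc_self hs₀.2⟩, hs₀, hqs₀, hs₀r⟩
  obtain ⟨n, hn⟩ := exists_subset_lineCharts_source (hbi := hbi) (isCompact_leafIcc (hbi := hbi) q r')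
  obtain ⟨s, hsS, hsmax⟩ := Set.exists_max_image S (lineCharts hbi x n) hSf ⟨s₀, hs₀S⟩
  refine ⟨s, hsS.2.1, hsS.2.2.1, hsS.2.2.2, fun s' hs' hqs' hs'r hlt ↦ ?_⟩
  have hs'S : s' ∈ S := ⟨⟨⟨leafLT_asymm hqs', leafLT_asymm hs'r⟩, hs'.1, Ioo_subset_Icc_self hs'.2⟩, hs', hqs', hs'r⟩
  have hle := hsmax s' hs'S
  have hlt' := (leafLT_iff (hn hsS.1.1) (hn hs'S.1.1)).1 hlt
  linarith

/-- **Monotone chains.** Let `p < q` be consecutive window crossings (no crossing strictly between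
them has height in the window). Then every later window crossing `r'` lies beyond `q` in the
direction from `ht p` to `ht q`, and beyond every window crossing strictly between `q` and `r'`:
the heights of the window crossings after `p` progress strictly monotonically. By strong
induction on the number of window crossings in `(q, r')`, peeling off the last one and applying
`SackData.beyond_of_lt` to the last consecutive pair. [folklore] -/
theorem wcrossing_monotone (he : e ∈ F.atlas) {ι : X → ℂ} (hι : IsOpenEmbedding ι) {T₁ T₂ : ℝ} {p q : F.Leaf x}
    (hpq : leafLT hbi p q) (hp : IsWCrossing e u₀ T₁ T₂ p) (hq : IsWCrossing e u₀ T₁ T₂ q)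
    (hcons : ∀ s, leafLT hbi p s → leafLT hbi s q → IsCrossing e u₀ s → ht e s ∉ Ioo T₁ T₂)
    {r' : F.Leaf x} (hqr' : leafLT hbi q r') (hr' : IsWCrossing e u₀ T₁ T₂ r') :
    0 < (ht e r' - ht e q) * (ht e q - ht e p) ∧
      ∀ s, IsWCrossing e u₀ T₁ T₂ s → leafLT hbi q s → leafLT hbi s r' → 0 < (ht e r' - ht e s) * (ht e q - ht e p) := by
  -- the basic step: a consecutive pair `(a, b)` in direction `σ = sign (ht q - ht p)` pushes later window crossings beyond `b`
  have step : ∀ a b : F.Leaf x, leafLT hbi a b → IsWCrossing e u₀ T₁ T₂ a → IsWCrossing e u₀ T₁ T₂ b →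
      (∀ s, leafLT hbi a s → leafLT hbi s b → IsCrossing e u₀ s → ht e s ∉ Ioo T₁ T₂) →
      0 < (ht e b - ht e a) * (ht e q - ht e p) →
      ∀ r, leafLT hbi b r → IsWCrossing e u₀ T₁ T₂ r → 0 < (ht e r - ht e b) * (ht e q - ht e p) := by
    intro a b hab ha hb hcons' hdir r hbr hr
    have hsucc : ∀ s, leafLT hbi a s → leafLT hbi s b → IsCrossing e u₀ s → ht e s ∉ uIcc (ht e b) (ht e a) := by
      intro s h₁ h₂ hs hsI
      refine hcons' s h₁ h₂ hs ?_
      rcases mem_uIcc.1 hsI with ⟨h1, h2⟩ | ⟨h1, h2⟩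
      · exact ⟨by linarith [hb.2.1], by linarith [ha.2.2]⟩
      · exact ⟨by linarith [ha.2.1], by linarith [hb.2.2]⟩
    set D : SackData hbi x e u₀ := ⟨a, b, hab, ha.1, hb.1, hsucc⟩ with hD
    have hT₁ : T₁ < D.tlo := lt_min ha.2.1 hb.2.1
    have hT₂ : D.thi < T₂ := max_lt ha.2.2 hb.2.2
    have key := D.beyond_of_lt he hι hT₁ hT₂ hcons' hbr hr.1 hr.2
    -- `key : 0 < (ht r - ht b) * (ht b - ht a)`; transfer the sign through `hdir`
    exact mul_pos_of_mul_pos_of_mul_pos key hdir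
  have hdir₀ : 0 < (ht e q - ht e p) * (ht e q - ht e p) := by
    have hne : ht e q - ht e p ≠ 0 := fun h ↦ by
      have := hq.1.eq_of_ht_eq hp.1 (by linarith)
      rw [this] at hpq; exact leafLT_irrefl _ hpq
    exact mul_self_pos.2 hne
  -- strong induction on the number of window crossings in `[q, r']`
  suffices H : ∀ (n : ℕ) (r' : F.Leaf x),
      (finite_crossings_leafIcc hbi he isClosed_Icc (Metric.isBounded_Icc T₁ T₂) q r' (u₀ := u₀)).toFinset.card ≤ n →
      leafLT hbi q r' → IsWCrossing e u₀ T₁ T₂ r' →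
      0 < (ht e r' - ht e q) * (ht e q - ht e p) ∧
        ∀ s, IsWCrossing e u₀ T₁ T₂ s → leafLT hbi q s → leafLT hbi s r' →
          0 < (ht e r' - ht e s) * (ht e q - ht e p) from H _ r' le_rfl hqr' hr'
  intro n
  induction n with
  | zero =>
    intro r' hcard hqr' hr'
    have hmem : r' ∈ (finite_crossings_leafIcc hbi he isClosed_Icc (Metric.isBounded_Icc T₁ T₂) q r' (u₀ := u₀)).toFinset := by
      rw [Set.Finite.mem_toFinset]
      exact ⟨right_mem_leafIcc (leafLT_asymm hqr'), hr'.1, Ioo_subset_Icc_self hr'.2⟩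
    have := Finset.card_pos.2 ⟨r', hmem⟩
    omega
  | succ n ih =>
    intro r' hcard hqr' hr'
    by_cases hex : ∃ s, IsWCrossing e u₀ T₁ T₂ s ∧ leafLT hbi q s ∧ leafLT hbi s r'
    · -- peel off the last window crossing `s⋆` before `r'`
      obtain ⟨t, htW, hqt, htr', hlast⟩ := exists_last_wcrossing (hbi := hbi) he hex
      -- fewer window crossings in `[q, t]`
      have hcard' : (finite_crossings_leafIcc hbi he isClosed_Icc (Metric.isBounded_Icc T₁ T₂) q t (u₀ := u₀)).toFinset.card ≤ n := by
        have hss : (finite_crossings_leafIcc hbi he isClosed_Icc (Metric.isBounded_Icc T₁ T₂) q t (u₀ := u₀)).toFinset ⊂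
            (finite_crossings_leafIcc hbi he isClosed_Icc (Metric.isBounded_Icc T₁ T₂) q r' (u₀ := u₀)).toFinset := by
          rw [Set.Finite.toFinset_ssubset_toFinset]
          refine ⟨?_, fun h ↦ ?_⟩
          · rintro w ⟨⟨hw₁, hw₂⟩, hw⟩
            exact ⟨⟨hw₁, fun h ↦ hw₂ (leafLT_trans htr' h)⟩, hw⟩
          · have hr'mem : r' ∈ {r ∈ leafIcc hbi q r' | IsCrossing e u₀ r ∧ ht e r ∈ Icc T₁ T₂} :=
              ⟨right_mem_leafIcc (leafLT_asymm hqr'), hr'.1, Ioo_subset_Icc_self hr'.2⟩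
            exact (h hr'mem).1.2 htr'
        have := Finset.card_lt_card hss
        omega
      obtain ⟨ih₁, ih₂⟩ := ih t hcard' hqt htW
      -- the consecutive pair ending at `t`: `(t₀, t)` with `t₀` the last window crossing before `t`, or `q`
      have hcons_t : ∀ s, leafLT hbi t s → leafLT hbi s r' → IsCrossing e u₀ s → ht e s ∉ Ioo T₁ T₂ :=
        fun s h₁ h₂ hs hsI ↦ hlast s ⟨hs, hsI⟩ (leafLT_trans hqt h₁) h₂ h₁
      have hpush : 0 < (ht e r' - ht e t) * (ht e q - ht e p) := by
        by_cases hex' : ∃ s, IsWCrossing e u₀ T₁ T₂ s ∧ leafLT hbi q s ∧ leafLT hbi s t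
        · obtain ⟨t₀, ht₀, hqt₀, ht₀t, hlast₀⟩ := exists_last_wcrossing (hbi := hbi) he hex'
          have hdir : 0 < (ht e t - ht e t₀) * (ht e q - ht e p) := ih₂ t₀ ht₀ hqt₀ ht₀t
          exact step t₀ t ht₀t ht₀ htW (fun s h₁ h₂ hs hsI ↦ hlast₀ s ⟨hs, hsI⟩ (leafLT_trans hqt₀ h₁) h₂ h₁) hdir
            r' htr' hr'
        · push Not at hex'
          exact step q t hqt hq htW (fun s h₁ h₂ hs hsI ↦ hex' s ⟨hs, hsI⟩ h₁ h₂) ih₁ r' htr' hr'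
      refine ⟨?_, fun s hs hqs hsr' ↦ ?_⟩
      · -- `r'` beyond `t` beyond `q`
        have hring : (ht e r' - ht e q) * (ht e q - ht e p) =
            (ht e r' - ht e t) * (ht e q - ht e p) + (ht e t - ht e q) * (ht e q - ht e p) := by ring
        rw [hring]; exact add_pos hpush ih₁
      · rcases leafLT_trichotomy (hbi := hbi) s t with h | h | h
        · have h' := ih₂ s hs hqs h
          have hring : (ht e r' - ht e s) * (ht e q - ht e p) =
              (ht e r' - ht e t) * (ht e q - ht e p) + (ht e t - ht e s) * (ht e q - ht e p) := by ring
          rw [hring]; exact add_pos hpush h'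
        · rw [h]; exact hpush
        · exact absurd h (hlast s hs hqs hsr')
    · -- no window crossing strictly between: `(q, r')` is consecutive
      push Not at hex
      refine ⟨step p q hpq hp hq hcons hdir₀ r' hqr' hr', fun s hs hqs hsr' ↦ ?_⟩
      exact absurd hsr' (hex s hs hqs)

end Monotone

end Literature.Topology.PlanarFoliations
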